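import Mathlib
import Literature.Analysis.ODE.FloquetAdjoint
import Summits.NavierStokesRegularity.NavierStokesRegularity.Theorems.FilamentSkeletonRssBoxFrequencyEnergy

/-!
# Route `FilamentSkeletonRss` · `SkeletonJ1L` (stmt-NavierStokesRegularity-23296) · alt line `fuchsian_newton_L`, stub (R♭)
# `BoxFrequencyInverseL` — PROVED (existence half + the landed a-priori bound)

The text of `Cruxes/SkeletonJ1L/Lines/fuchsian_newton_L.lean §3b  BoxFrequencyInverseL` VERBATIM: for the frozen stagnation box
on the frequency side, the linear system `w′(Z + kZ′) + m(k)·i·Z + S Z = f` on `k > 0` (typed as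
`HasDerivAt Z ((w′k)⁻¹ • (f k − (w′•Z k + (m k·i)·Z k + S (Z k)))) k`), with `0 < w′`, `S` real-linear, `Re(z̄·Sz) ≤ lam‖z‖²`,
`θ > ½ + lam/w′`, `h ≥ 0`, `m`, `f` continuous on `(0,∞)`, `f = 0` beyond `kf > 0` and `e^{2hk}k^{2θ}‖f‖²` integrable, there is a
solution `Z` on ALL of `k > 0`, vanishing beyond `kf`, with integrable weighted energy and
`∫ e^{2hk}k^{2θ}‖Z‖² ≤ (w′(θ−½) − lam)⁻² ∫ e^{2hk}k^{2θ}‖f‖²`.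
Proof.  EXISTENCE: the substitution `k = e^s` turns the Euler system into the forced linear system
`Y′(s) = B(s) Y(s) + g(s)`, `B(s) = (w′)⁻¹ • (−w′·1 − (m(e^s) i)· − S)`, `g(s) = (w′)⁻¹ • f(e^s)` with coefficients continuous on the
whole line, solved through `Y(log kf) = 0` by the tree's Cauchy–Lipschitz theorem for forced linear systems
(`Literature.Analysis.ODE.Floquet.exists_forced_solution`); `Z = Y ∘ log` on `(0, kf]`, `Z = 0` beyond (the one-sided derivatives at
`kf` both vanish because `f(kf) = 0`).  INTEGRABILITY near `k = 0`: on every `[ε, kf]` the weighted energy is continuous, and the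
backward energy inequality of `Theorems.BoxFrequencyEnergy` (`kEnergy_deriv_ge`, skew term gone) integrated on `[ε, kf]` bounds
`∫_{(ε,kf]} e^{2hk}k^{2θ}‖Z‖²` uniformly in `ε`; `integrableOn_Ioc_of_intervalIntegral_norm_bounded_left` gives integrability on
`(0, kf]`.  BOUND: `Theorems.BoxFrequencyEnergy.boxFrequency_apriori` (p816160) on `(0, kf]`, and `(0,∞) = (0,kf] ∪ (kf,∞)` where
both integrands vanish.
HONEST FRAMING: an elementary linear-ODE lemma serving a plan (alt line `fuchsian_newton_L`, not the registered skeleton) about a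
HYPOTHETICAL filament skeleton on the NEGATIVE side of a MODEL route; no registered stub of 23296 is closed; nothing here bears on
Navier–Stokes regularity or blow-up.  `--supports stmt-NavierStokesRegularity-23296`.
-/

set_option linter.dupNamespace false

noncomputable section

namespace Summit.NavierStokesRegularity.NavierStokesRegularity.Theorems.BoxFrequencyInverse

open Real Set MeasureTheory Filter Topology
open scoped InnerProductSpace ComplexConjugate

/-- **(R♭) `BoxFrequencyInverseL` of the alt line `fuchsian_newton_L` (crux `SkeletonJ1L`, 23296), verbatim text, proved.**
Existence of the solution of the frozen stagnation-box system on `k > 0` vanishing beyond `kf`, with integrable weighted energy and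
the weighted `L²` bound with constant `(w′(θ−½) − lam)⁻²`.  See the module docstring for the proof (the forced linear system after
`k = e^s` is solved by the tree's `Literature.Analysis.ODE.Floquet.exists_forced_solution`, Hale 1980 Ch. III §1). [folklore] -/
theorem boxFrequencyInverseL :
    ∀ (w' lam θ h kf : ℝ) (S : ℂ →L[ℝ] ℂ) (m : ℝ → ℝ) (f : ℝ → ℂ),
    0 < w' → (∀ z : ℂ, (starRingEnd ℂ z * S z).re ≤ lam * ‖z‖ ^ 2) → 1 / 2 + lam / w' < θ → 0 ≤ h → 0 < kf →
    ContinuousOn m (Set.Ioi 0) → ContinuousOn f (Set.Ioi 0) → (∀ k, kf ≤ k → f k = 0) →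
    IntegrableOn (fun k : ℝ => Real.exp (2 * h * k) * k ^ (2 * θ) * ‖f k‖ ^ 2) (Set.Ioi 0) →
    ∃ Z : ℝ → ℂ,
      (∀ k, 0 < k → HasDerivAt Z ((w' * k)⁻¹ • (f k - (w' • Z k + ((m k : ℂ) * Complex.I) * Z k + S (Z k)))) k) ∧
      (∀ k, kf ≤ k → Z k = 0) ∧
      IntegrableOn (fun k : ℝ => Real.exp (2 * h * k) * k ^ (2 * θ) * ‖Z k‖ ^ 2) (Set.Ioi 0) ∧
      ∫ k in Set.Ioi (0:ℝ), Real.exp (2 * h * k) * k ^ (2 * θ) * ‖Z k‖ ^ 2 ≤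
        ((w' * (θ - 1 / 2) - lam)⁻¹) ^ 2 * ∫ k in Set.Ioi (0:ℝ), Real.exp (2 * h * k) * k ^ (2 * θ) * ‖f k‖ ^ 2 := by
  intro w' lam θ h kf S m f hw hS hθ hh hkf hm hf hfz hIf
  /- Step 1: the substituted forced linear system on the whole line `s = log k`. -/
  set Bc : ℝ → (ℂ →L[ℝ] ℂ) := fun s =>
    (w')⁻¹ • (-(w' • (1 : ℂ →L[ℝ] ℂ)) - ContinuousLinearMap.mul ℝ ℂ (((m (Real.exp s) : ℝ) : ℂ) * Complex.I) - S) with hBc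
  set g : ℝ → ℂ := fun s => (w')⁻¹ • f (Real.exp s) with hg
  have hmexp : Continuous fun s => m (Real.exp s) :=
    hm.comp_continuous Real.continuous_exp fun s => Real.exp_pos s
  have hfexp : Continuous fun s => f (Real.exp s) :=
    hf.comp_continuous Real.continuous_exp fun s => Real.exp_pos s
  have h1 : Continuous fun s => ContinuousLinearMap.mul ℝ ℂ (((m (Real.exp s) : ℝ) : ℂ) * Complex.I) :=
    (ContinuousLinearMap.mul ℝ ℂ).continuous.comp ((Complex.continuous_ofReal.comp hmexp).mul continuous_const)
  have hBc_cont : Continuous Bc := by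
    have h2 : Continuous fun s =>
        -(w' • (1 : ℂ →L[ℝ] ℂ)) - ContinuousLinearMap.mul ℝ ℂ (((m (Real.exp s) : ℝ) : ℂ) * Complex.I) - S :=
      (continuous_const.sub h1).sub continuous_const
    exact h2.const_smul (w')⁻¹
  have hg_cont : Continuous g := by
    have h2 : Continuous fun s => (w')⁻¹ • f (Real.exp s) := hfexp.const_smul (w')⁻¹
    exact h2
  obtain ⟨Y, hY0, hY⟩ :=
    Literature.Analysis.ODE.Floquet.exists_forced_solution hBc_cont hg_cont (Real.log kf) (0 : ℂ)
  have hfield : ∀ s z, Bc s z + g s =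
      (w')⁻¹ • (f (Real.exp s) - (w' • z + ((m (Real.exp s) : ℂ) * Complex.I) * z + S z)) := by
    intro s z
    simp only [hBc, hg, _root_.smul_apply, _root_.sub_apply, _root_.neg_apply,
      one_apply_eq_self, ContinuousLinearMap.mul_apply', Complex.real_smul]
    ring
  /- Step 2: `Z = Y ∘ log` on `(0, kf]`, `0` beyond. -/
  set Z : ℝ → ℂ := fun k => if k ≤ kf then Y (Real.log k) else 0 with hZ
  have hZ_le : ∀ k, k ≤ kf → Z k = Y (Real.log k) := fun k hk => by simp [hZ, hk]
  have hZ_gt : ∀ k, kf < k → Z k = 0 := fun k hk => by simp [hZ, not_le.2 hk]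
  have hZkf : Z kf = 0 := by rw [hZ_le kf le_rfl, hY0]
  have hZ_ge : ∀ k, kf ≤ k → Z k = 0 := fun k hk => by
    rcases hk.eq_or_lt with h' | h'
    · rw [← h']; exact hZkf
    · exact hZ_gt k h'
  set F : ℝ → ℂ := fun k => (w' * k)⁻¹ • (f k - (w' • Z k + ((m k : ℂ) * Complex.I) * Z k + S (Z k))) with hF
  -- the chain rule for `Y ∘ log`
  have hYl : ∀ k, 0 < k → HasDerivAt (fun x => Y (Real.log x))
      ((w' * k)⁻¹ • (f k - (w' • Y (Real.log k) + ((m k : ℂ) * Complex.I) * Y (Real.log k) + S (Y (Real.log k))))) k := by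
    intro k hk
    have h1 := (hY (Real.log k)).scomp k (Real.hasDerivAt_log hk.ne')
    rw [hfield, Real.exp_log hk, smul_smul, ← mul_inv_rev] at h1
    exact h1
  have hderiv_lt : ∀ k, 0 < k → k < kf → HasDerivAt Z (F k) k := by
    intro k hk hkk
    have hev : Z =ᶠ[𝓝 k] fun x => Y (Real.log x) :=
      Filter.eventuallyEq_of_mem (Iio_mem_nhds hkk) fun x hx => hZ_le x (le_of_lt hx)
    have h1 := (hYl k hk).congr_of_eventuallyEq hev
    rw [← hZ_le k hkk.le] at h1
    exact h1
  have hderiv_gt : ∀ k, kf < k → HasDerivAt Z (F k) k := by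
    intro k hkk
    have hev : Z =ᶠ[𝓝 k] fun _ => (0:ℂ) :=
      Filter.eventuallyEq_of_mem (Ioi_mem_nhds hkk) fun x hx => hZ_gt x hx
    have h1 : HasDerivAt Z 0 k := (hasDerivAt_const k (0:ℂ)).congr_of_eventuallyEq hev
    have h2 : F k = 0 := by
      simp only [hF, hZ_gt k hkk, hfz k hkk.le, smul_zero, mul_zero, map_zero, add_zero, sub_self]
    rw [h2]; exact h1
  have hderiv_eq : HasDerivAt Z (F kf) kf := by
    have hFkf : F kf = 0 := by
      simp only [hF, hZkf, hfz kf le_rfl, smul_zero, mul_zero, map_zero, add_zero, sub_self]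
    rw [hFkf]
    have hl : HasDerivWithinAt Z 0 (Iic kf) kf := by
      have h1 := hYl kf hkf
      simp only [hY0, hfz kf le_rfl, smul_zero, mul_zero, map_zero, add_zero, sub_self] at h1
      exact h1.hasDerivWithinAt.congr_of_mem (fun x hx => hZ_le x hx) self_mem_Iic
    have hr : HasDerivWithinAt Z 0 (Ici kf) kf :=
      (hasDerivWithinAt_const kf (Ici kf) (0:ℂ)).congr_of_mem (fun x hx => hZ_ge x hx) self_mem_Ici
    have := hl.union hr
    rwa [Iic_union_Ici, hasDerivWithinAt_univ] at this
  have hderiv : ∀ k, 0 < k → HasDerivAt Z (F k) k := by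
    intro k hk
    rcases lt_trichotomy k kf with h1 | h1 | h1
    · exact hderiv_lt k hk h1
    · rw [h1]; exact hderiv_eq
    · exact hderiv_gt k h1
  have hZcont : ∀ k, 0 < k → ContinuousAt Z k := fun k hk => (hderiv k hk).continuousAt
  /- Step 3: the weighted energies. -/
  set E : ℝ → ℝ := fun k => Real.exp (2 * h * k) * k ^ (2 * θ) * ‖Z k‖ ^ 2 with hE
  set Wf : ℝ → ℝ := fun k => Real.exp (2 * h * k) * k ^ (2 * θ) * ‖f k‖ ^ 2 with hWf
  have hWf_nn : ∀ k, 0 < k → 0 ≤ Wf k := fun k hk => by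
    have hq : 0 < k ^ (2 * θ) := Real.rpow_pos_of_pos hk _
    show 0 ≤ Real.exp (2 * h * k) * k ^ (2 * θ) * ‖f k‖ ^ 2
    positivity
  have hE_nn : ∀ k, 0 < k → 0 ≤ E k := fun k hk => by
    have hq : 0 < k ^ (2 * θ) := Real.rpow_pos_of_pos hk _
    show 0 ≤ Real.exp (2 * h * k) * k ^ (2 * θ) * ‖Z k‖ ^ 2
    positivity
  have hEcont : ∀ k, 0 < k → ContinuousAt E k := by
    intro k hk
    have h1 : ContinuousAt (fun k : ℝ => Real.exp (2 * h * k)) k := by fun_prop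
    have h2 : ContinuousAt (fun k : ℝ => k ^ (2 * θ)) k := Real.continuousAt_rpow_const _ _ (Or.inl hk.ne')
    have h3 : ContinuousAt (fun k => ‖Z k‖ ^ 2) k := ((hZcont k hk).norm).pow 2
    exact (h1.mul h2).mul h3
  have hEint : ∀ a b : ℝ, 0 < a → IntegrableOn E (Icc a b) := by
    intro a b ha
    refine ContinuousOn.integrableOn_Icc fun x hx => ?_
    exact (hEcont x (ha.trans_le hx.1)).continuousWithinAt
  have hE_zero : ∀ k ∈ Ioi kf, E k = 0 := fun k hk => by
    simp [hE, hZ_gt k hk]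
  have hW_zero : ∀ k ∈ Ioi kf, Wf k = 0 := fun k hk => by
    simp [hWf, hfz k (le_of_lt hk)]
  /- Step 4: the energy bound on every `(ε, kf]` (backward energy inequality, skew term gone). -/
  set A : ℝ := θ - 1 / 2 - lam / w' with hAdef
  have hA : 0 < A := by
    have h1 : lam / w' < θ - 1 / 2 := by linarith
    rw [hAdef]; linarith
  set If : ℝ := ∫ k in Ioi (0:ℝ), Wf k with hIfdef
  set G : ℝ → ℝ := fun k => k * E k with hG
  set G' : ℝ → ℝ := fun k => E k + k * (Real.exp (2 * h * k) * (2 * h * k ^ (2 * θ) * ‖Z k‖ ^ 2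
      + 2 * θ * k ^ (2 * θ - 1) * ‖Z k‖ ^ 2 + k ^ (2 * θ) * (2 * ⟪Z k, F k⟫_ℝ))) with hG'
  have hGd : ∀ k, 0 < k → HasDerivAt G (G' k) k := by
    intro k hk
    have h1 := (hasDerivAt_id' k).mul
      (Summit.NavierStokesRegularity.NavierStokesRegularity.Theorems.BoxFrequencyEnergy.weightedEnergy_hasDerivAt
        (h := h) (θ := θ) hk (hderiv k hk))
    refine h1.congr_deriv ?_
    simp only [hG', hE, one_mul]
  have hpt : ∀ k, 0 < k → A * E k - (w' ^ 2 * A)⁻¹ * Wf k ≤ G' k := fun k hk =>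
    Summit.NavierStokesRegularity.NavierStokesRegularity.Theorems.BoxFrequencyEnergy.kEnergy_deriv_ge
      (mk := m k) (fk := f k) (Zk := Z k) hw hk hh hA hS rfl
  have hstep : ∀ ε, 0 < ε → ε ≤ kf → ∫ k in Ioc ε kf, E k ≤ (w' ^ 2 * A)⁻¹ / A * If := by
    intro ε hε hεkf
    have hpos : ∀ x ∈ Icc ε kf, 0 < x := fun x hx => hε.trans_le hx.1
    have hIZ' : IntegrableOn E (Icc ε kf) := hEint ε kf hε
    have hIf' : IntegrableOn Wf (Icc ε kf) := hIf.mono_set fun x hx => (hpos x hx : x ∈ Ioi (0:ℝ))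
    have hφint : IntegrableOn (fun k => A * E k - (w' ^ 2 * A)⁻¹ * Wf k) (Icc ε kf) :=
      (hIZ'.const_mul A).sub (hIf'.const_mul _)
    have hcont : ContinuousOn G (Icc ε kf) := fun x hx => (hGd x (hpos x hx)).continuousAt.continuousWithinAt
    have hFTC := intervalIntegral.integral_le_sub_of_hasDeriv_right_of_le hεkf hcont
      (fun x hx => (hGd x (hpos x ⟨hx.1.le, hx.2.le⟩)).hasDerivWithinAt) hφint
      (fun x hx => hpt x (hpos x ⟨hx.1.le, hx.2.le⟩))
    have hGkf : G kf = 0 := by simp [hG, hE, hZkf]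
    have hrhs : G kf - G ε ≤ 0 := by
      rw [hGkf, zero_sub, neg_nonpos]
      exact mul_nonneg hε.le (hE_nn ε hε)
    have hIZi : IntervalIntegrable E volume ε kf :=
      (intervalIntegrable_iff_integrableOn_Ioc_of_le hεkf).2 (hIZ'.mono_set Ioc_subset_Icc_self)
    have hIfi : IntervalIntegrable Wf volume ε kf :=
      (intervalIntegrable_iff_integrableOn_Ioc_of_le hεkf).2 (hIf'.mono_set Ioc_subset_Icc_self)
    have hsplit : ∫ k in ε..kf, (A * E k - (w' ^ 2 * A)⁻¹ * Wf k) =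
        A * (∫ k in ε..kf, E k) - (w' ^ 2 * A)⁻¹ * (∫ k in ε..kf, Wf k) := by
      rw [intervalIntegral.integral_sub (hIZi.const_mul A) (hIfi.const_mul _), intervalIntegral.integral_const_mul,
        intervalIntegral.integral_const_mul]
    have hineq : A * (∫ k in ε..kf, E k) ≤ (w' ^ 2 * A)⁻¹ * (∫ k in ε..kf, Wf k) := by linarith [hFTC, hrhs, hsplit]
    rw [intervalIntegral.integral_of_le hεkf, intervalIntegral.integral_of_le hεkf] at hineq
    have hWle : ∫ k in Ioc ε kf, Wf k ≤ If :=
      setIntegral_mono_set hIf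
        (ae_restrict_of_forall_mem measurableSet_Ioi fun k hk => hWf_nn k hk)
        (LE.le.eventuallyLE fun x hx => (hε.trans hx.1 : x ∈ Ioi (0:ℝ)))
    have hc : 0 ≤ (w' ^ 2 * A)⁻¹ := by positivity
    have h3 : A * (∫ k in Ioc ε kf, E k) ≤ (w' ^ 2 * A)⁻¹ * If := hineq.trans (mul_le_mul_of_nonneg_left hWle hc)
    rw [div_mul_eq_mul_div, le_div_iff₀ hA]
    linarith
  /- Step 5: integrability of the weighted energy of `Z` on `(0, kf]`, then on `(0, ∞)`. -/
  have hIZ : IntegrableOn E (Ioc 0 kf) := by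
    have hfi : ∀ i : ℕ, IntegrableOn E (Ioc (kf / ((i:ℝ) + 2)) kf) := fun i =>
      (hEint _ kf (by positivity)).mono_set Ioc_subset_Icc_self
    have ha : Tendsto (fun i : ℕ => kf / ((i:ℝ) + 2)) atTop (𝓝 0) :=
      tendsto_const_nhds.div_atTop (tendsto_atTop_add_const_right _ _ tendsto_natCast_atTop_atTop)
    refine integrableOn_Ioc_of_intervalIntegral_norm_bounded_left (I := (w' ^ 2 * A)⁻¹ / A * If) hfi ha ?_
    refine Filter.Eventually.of_forall fun i => ?_
    have hεpos : 0 < kf / ((i:ℝ) + 2) := by positivity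
    have hεle : kf / ((i:ℝ) + 2) ≤ kf := div_le_self hkf.le (by linarith [(i.cast_nonneg : (0:ℝ) ≤ i)])
    calc ∫ x in Ioc (kf / ((i:ℝ) + 2)) kf, ‖E x‖ = ∫ x in Ioc (kf / ((i:ℝ) + 2)) kf, E x := by
          refine setIntegral_congr_fun measurableSet_Ioc fun x hx => ?_
          exact Real.norm_of_nonneg (hE_nn x (hεpos.trans hx.1))
      _ ≤ (w' ^ 2 * A)⁻¹ / A * If := hstep _ hεpos hεle
  have hunion : Ioc 0 kf ∪ Ioi kf = Ioi 0 := Ioc_union_Ioi_eq_Ioi hkf.le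
  have hIZ_tail : IntegrableOn E (Ioi kf) :=
    (integrableOn_congr_fun (fun k hk => hE_zero k hk) measurableSet_Ioi).2 integrableOn_zero
  have hIZ_Ioi : IntegrableOn E (Ioi 0) := by
    rw [← hunion]; exact hIZ.union hIZ_tail
  have hIf_Ioc : IntegrableOn Wf (Ioc 0 kf) := hIf.mono_set fun x hx => (hx.1 : x ∈ Ioi (0:ℝ))
  have hIf_tail : IntegrableOn Wf (Ioi kf) := hIf.mono_set fun x hx => (hkf.trans hx : x ∈ Ioi (0:ℝ))
  have hE_split : ∫ k in Ioi (0:ℝ), E k = ∫ k in Ioc 0 kf, E k := by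
    rw [← hunion, setIntegral_union (Ioc_disjoint_Ioi_same) measurableSet_Ioi hIZ hIZ_tail,
      setIntegral_congr_fun measurableSet_Ioi hE_zero]
    simp
  have hW_split : ∫ k in Ioi (0:ℝ), Wf k = ∫ k in Ioc 0 kf, Wf k := by
    rw [← hunion, setIntegral_union (Ioc_disjoint_Ioi_same) measurableSet_Ioi hIf_Ioc hIf_tail,
      setIntegral_congr_fun measurableSet_Ioi hW_zero]
    simp
  /- Step 6: the a-priori bound on `(0, kf]` and assembly. -/
  have hapr :=
    Summit.NavierStokesRegularity.NavierStokesRegularity.Theorems.BoxFrequencyEnergy.boxFrequency_apriori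
      (m := m) (f := f) (Z := Z) hw hS hθ hh hkf (fun k hk => hderiv k hk.1) hZkf hIZ hIf_Ioc
  refine ⟨Z, hderiv, hZ_ge, hIZ_Ioi, ?_⟩
  show ∫ k in Ioi (0:ℝ), E k ≤ ((w' * (θ - 1 / 2) - lam)⁻¹) ^ 2 * ∫ k in Ioi (0:ℝ), Wf k
  rw [hE_split, hW_split]
  exact hapr

end Summit.NavierStokesRegularity.NavierStokesRegularity.Theorems.BoxFrequencyInverse

end
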